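import Summits.ABC.IUTFork.Repair.RHLabelCutJ3
import HarnessLib

/-!
# R-H round 1, pair 9 (`label-cut-j3`) — k2 BRIDGE against the LANDED deciding decl `Summit.ABC.IUTFork.Repair.RH.LabelCutJ3.HStar`
(scratch block offered by the typer abc-iut-rh-typ-9 to the tester abc-iut-rh-tst-9 for its RHLabelCutJ3K2 file; PROOF-ONLY)

The unramified-odd local negative BITES `H⋆_9`-as-landed exactly at genuine data with an ABSOLUTELY UNRAMIFIED bad place `w` (`e(K_w/ℚ_p) = 1`):
the label `2` (index `i = 1`, available since `l ≥ 5`) is inside the window `j ≤ 3`, and at `e_w = 1` the tame closed form reads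
`t_{q,w} ∈ t_{q,w}^{4}·ℐ_{K_w} ⟺ 3·P_w ≤ 0`, false for the integral q-degree `P_w ≥ 1`. (Empty class under admissibility — `e(w|v) ≥ l` at bad
places of admissible data — so at ADMISSIBLE genuine data the family MISSES `H⋆_9`; this block is the kernel form of the tester's U1-genuine item.)
[claim: Mochizuki2012, status: disputed]
-/

noncomputable section

open Set Metric Function NumberField IsDedekindDomain
open scoped Pointwise

namespace Summit.ABC.IUTFork.Repair.RH.LabelCutJ3K2Bridge

open Literature.AnabelianGeometry.AbsoluteAnabelian Literature.IUT.LogThetaLattice Literature.IUT.LogVolume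
  Literature.IUT.HodgeTheaters Literature.NumberTheory.NumberFields
open Summit.ABC.IUTFork.Thm311 Summit.ABC.IUTFork.Thm311.Real Summit.ABC.IUTFork.Cor312 Summit.ABC.IUTFork.Cor312Prov
  Summit.ABC.IUTFork.Repair.RH.LabelCutJ3

variable {F K Fbar : Type} [Field F] [NumberField F] [Field K] [NumberField K] [Algebra F K] [Field Fbar]
  [Algebra F Fbar] [Algebra K Fbar] {E : WeierstrassCurve F} [E.IsElliptic] {l : ℕ} {Pb : BadPlacePredicates K}
  (D : InitialThetaData F K Fbar E l Pb)
  (tq : ∀ (pp : Nat.Primes) (x : (thetaIndex (pilotDataOfK D K)).Fibre (.inr pp)),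
    haveI : Fact (pp : ℕ).Prime := ⟨pp.2⟩; kOf (pilotDataOfK D K) pp.1 x)
  (htq0 : ∀ pp x, tq pp x ≠ 0)
  (htq : ∀ (pp : Nat.Primes) (x : (thetaIndex (pilotDataOfK D K)).Fibre (.inr pp)),
    haveI : Fact (pp : ℕ).Prime := ⟨pp.2⟩
    Real.log ‖tq pp x‖ = -((pilotDataOfK D K).qPilot (placeOf (pilotDataOfK D K) pp.1 x)) *
      logNorm K (placeOf (pilotDataOfK D K) pp.1 x) / localDegree K (placeOf (pilotDataOfK D K) pp.1 x))

include htq0 htq in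
/-- **THE UNRAMIFIED-ODD NEGATIVE BITES `H⋆_9` AT AN ABSOLUTELY UNRAMIFIED BAD PLACE** (realising q-idele): if some bad place `w ∣ p` of
`pilotDataOfK D K` has `e(K_w/ℚ_p) = 1`, then `H⋆_9` fails (label `2`: `3·P_w ≤ e_w − 1 = 0` is false, `P_w ≥ 1` by [IUTchI] Ex. 3.2 (iv)).
[cite: Mochizuki2012, IUTchI Def. 3.1 (b) p. 61, Ex. 3.2 (iv) p. 71] [cite: MochizukiAbsTopIII2015, Def 5.4 (iii) p. 126] [claim: Mochizuki2012, status: disputed] -/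
theorem not_hStar_of_absRamificationIdx_eq_one (pp : Nat.Primes) (w : (thetaIndex (pilotDataOfK D K)).Fibre (.inr pp))
    (hw : haveI : Fact (pp : ℕ).Prime := ⟨pp.2⟩; placeOf (pilotDataOfK D K) pp.1 w ∈ (pilotDataOfK D K).S)
    (he1 : haveI : Fact (pp : ℕ).Prime := ⟨pp.2⟩; absRamificationIdx (pp : ℕ) (kOf (pilotDataOfK D K) pp.1 w) = 1) :
    ¬ HStar D tq := by
  haveI hF : Fact (pp : ℕ).Prime := ⟨pp.2⟩
  intro h
  obtain ⟨hp2, _⟩ := ne_two_and_ne_l_of_placeOf_mem_S_pilotDataOfK D pp w hw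
  have hp3 : 2 < (pp : ℕ) := lt_of_le_of_ne pp.2.two_le (Ne.symm hp2)
  have hram : (placeOf (pilotDataOfK D K) pp.1 w).asIdeal.ramificationIdx ℤ = 1 :=
    (absRamificationIdx_rescaledCompletion K (pp : ℕ) (placeOf (pilotDataOfK D K) pp.1 w)
      (natCast_mem_placeOf (pilotDataOfK D K) pp.1 w)).symm.trans he1
  obtain ⟨P, hP, hP1, _⟩ := exists_nat_qPilot_pilotDataOfK D hw
  have h2 : 1 < (pilotDataOfK D K).lstar := by rw [lstar_eq]; have := D.five_le_l; omega
  have hcell := h pp ⟨1, h2⟩ w hw (by norm_num)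
  have hle := (cell_iff_of_tame D tq htq0 htq pp w hp3 (by omega) hram hP (1 + 1)).1 hcell
  push_cast at hle
  have : (1 : ℤ) ≤ P := by exact_mod_cast hP1
  nlinarith

end Summit.ABC.IUTFork.Repair.RH.LabelCutJ3K2Bridge

end
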